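import Mathlib

/-!
# Crux `PeriodicWindows` (stmt-AtomisticToContinuum-3240), line `dense-laminar-hull` — stub HC, arithmetic
# `hc_hk_arith`: the far-layer constants `h_k` are nonnegative, `∑ 2k² h_k ≤ 1/5` and `∑ k³ h_k ≤ 2`

The hollow-closing step of the line uses the far-layer table
`h_k = 1/250` (`k ≤ 2`), `h_k = 1/12500` (`3 ≤ k ≤ 10`), `h_k = 24/((3/4)k)^6` (`k ≥ 11`)
(quadratic constants of the interaction of two layers at layer distance `k`). The competitor argument needs
`h_k ≥ 0`, `∑_{k=2}^K 2k² h_k ≤ 1/5` and `∑_{k=2}^K k³ h_k ≤ 2` for every `K`; this file is exactly that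
arithmetic.

Route: the finite parts `k = 2, …, 10` are the exact rationals `58/625` and `854/3125`; for `k ≥ 11` the terms
are `(196608/729) k⁻⁴` and `(98304/729) k⁻³`, and the telescoping bounds `3 (k+1)⁻⁴ ≤ k⁻³ - (k+1)⁻³`,
`2 (k+1)⁻³ ≤ k⁻² - (k+1)⁻²` give, by induction on `K ≥ 10`, the invariants
`∑_{k=2}^K 2k² h_k ≤ 58/625 + (65536/729)(1/1000 - K⁻³)` and `∑_{k=2}^K k³ h_k ≤ 854/3125 + (49152/729)(1/100 - K⁻²)`;
below `K = 10` the sums are monotone in `K` (nonnegative terms). All elementary. [folklore]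
-/

noncomputable section

namespace Summit.AtomisticToContinuum.Crystallization.Theorems.PeriodicWindowsDenseLaminarHull

open scoped BigOperators

/-- The far-layer constant `h_k` is nonnegative. [folklore] -/
theorem hkh_nonneg (k : ℕ) :
    0 ≤ (if k ≤ 2 then (1 : ℝ) / 250 else if k ≤ 10 then 1 / 12500 else 24 / ((3 : ℝ) / 4 * k) ^ 6) := by
  split_ifs <;> positivity

/-- `Finset.Icc 2 10 = {2, …, 10}` in `ℕ`. [folklore] -/
theorem hkh_Icc_two_ten : (Finset.Icc 2 10 : Finset ℕ) = {2, 3, 4, 5, 6, 7, 8, 9, 10} := by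
  ext x
  simp only [Finset.mem_Icc, Finset.mem_insert, Finset.mem_singleton]
  omega

/-- The finite part of the first sum: `∑_{k=2}^{10} 2k² h_k = 58/625`. [folklore] -/
theorem hkh_fin_sq : ∑ k ∈ Finset.Icc (2 : ℕ) 10, 2 * (k : ℝ) ^ 2 *
      (if k ≤ 2 then (1 : ℝ) / 250 else if k ≤ 10 then 1 / 12500 else 24 / ((3 : ℝ) / 4 * k) ^ 6) =
    58 / 625 := by
  rw [hkh_Icc_two_ten]
  norm_num [Finset.sum_insert]

/-- The finite part of the second sum: `∑_{k=2}^{10} k³ h_k = 854/3125`. [folklore] -/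
theorem hkh_fin_cube : ∑ k ∈ Finset.Icc (2 : ℕ) 10, (k : ℝ) ^ 3 *
      (if k ≤ 2 then (1 : ℝ) / 250 else if k ≤ 10 then 1 / 12500 else 24 / ((3 : ℝ) / 4 * k) ^ 6) =
    854 / 3125 := by
  rw [hkh_Icc_two_ten]
  norm_num [Finset.sum_insert]

/-- Telescoping step for the first tail (`K ≥ 10`):
`2(K+1)² · 24/((3/4)(K+1))⁶ = (65536/729) · 3 (K+1)⁻⁴ ≤ (65536/729) (K⁻³ - (K+1)⁻³)`,
the last step being `3K³ ≤ (K+1)(3K² + 3K + 1)`. [folklore] -/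
theorem hkh_step_sq (K : ℕ) (hK : 10 ≤ K) :
    2 * ((K : ℝ) + 1) ^ 2 * (24 / ((3 : ℝ) / 4 * ((K : ℝ) + 1)) ^ 6) ≤
      65536 / 729 * (1 / (K : ℝ) ^ 3 - 1 / ((K : ℝ) + 1) ^ 3) := by
  have hK' : (10 : ℝ) ≤ K := by exact_mod_cast hK
  have hx : 0 < (K : ℝ) := by linarith
  have hx1 : 0 < (K : ℝ) + 1 := by linarith
  have hx1' : (K : ℝ) + 1 ≠ 0 := hx1.ne'
  have key : 3 / ((K : ℝ) + 1) ^ 4 ≤ 1 / (K : ℝ) ^ 3 - 1 / ((K : ℝ) + 1) ^ 3 := by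
    rw [div_sub_div _ _ (pow_ne_zero _ hx.ne') (pow_ne_zero _ hx1'),
      div_le_div_iff₀ (by positivity) (by positivity)]
    nlinarith [mul_nonneg (pow_nonneg hx1.le 3) (show (0 : ℝ) ≤ 6 * (K : ℝ) ^ 2 + 4 * K + 1 by positivity),
      pow_pos hx 3, pow_pos hx1 3]
  calc 2 * ((K : ℝ) + 1) ^ 2 * (24 / ((3 : ℝ) / 4 * ((K : ℝ) + 1)) ^ 6)
      = 65536 / 729 * (3 / ((K : ℝ) + 1) ^ 4) := by
        field_simp
        ring
    _ ≤ 65536 / 729 * (1 / (K : ℝ) ^ 3 - 1 / ((K : ℝ) + 1) ^ 3) := by gcongr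

/-- Telescoping step for the second tail (`K ≥ 10`):
`(K+1)³ · 24/((3/4)(K+1))⁶ = (49152/729) · 2 (K+1)⁻³ ≤ (49152/729) (K⁻² - (K+1)⁻²)`,
the last step being `2K² ≤ (2K+1)(K+1)`. [folklore] -/
theorem hkh_step_cube (K : ℕ) (hK : 10 ≤ K) :
    ((K : ℝ) + 1) ^ 3 * (24 / ((3 : ℝ) / 4 * ((K : ℝ) + 1)) ^ 6) ≤
      49152 / 729 * (1 / (K : ℝ) ^ 2 - 1 / ((K : ℝ) + 1) ^ 2) := by
  have hK' : (10 : ℝ) ≤ K := by exact_mod_cast hK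
  have hx : 0 < (K : ℝ) := by linarith
  have hx1 : 0 < (K : ℝ) + 1 := by linarith
  have hx1' : (K : ℝ) + 1 ≠ 0 := hx1.ne'
  have key : 2 / ((K : ℝ) + 1) ^ 3 ≤ 1 / (K : ℝ) ^ 2 - 1 / ((K : ℝ) + 1) ^ 2 := by
    rw [div_sub_div _ _ (pow_ne_zero _ hx.ne') (pow_ne_zero _ hx1'),
      div_le_div_iff₀ (by positivity) (by positivity)]
    nlinarith [mul_nonneg (pow_nonneg hx1.le 2) (show (0 : ℝ) ≤ 3 * K + 1 by positivity),
      pow_pos hx 2, pow_pos hx1 2]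
  calc ((K : ℝ) + 1) ^ 3 * (24 / ((3 : ℝ) / 4 * ((K : ℝ) + 1)) ^ 6)
      = 49152 / 729 * (2 / ((K : ℝ) + 1) ^ 3) := by
        field_simp
        ring
    _ ≤ 49152 / 729 * (1 / (K : ℝ) ^ 2 - 1 / ((K : ℝ) + 1) ^ 2) := by gcongr

/-- Telescoped invariant of the first sum for `K ≥ 10`:
`∑_{k=2}^K 2k² h_k ≤ 58/625 + (65536/729)(1/1000 - K⁻³)`. [folklore] -/
theorem hkh_inv_sq (K : ℕ) (hK : 10 ≤ K) :
    ∑ k ∈ Finset.Icc 2 K, 2 * (k : ℝ) ^ 2 *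
        (if k ≤ 2 then (1 : ℝ) / 250 else if k ≤ 10 then 1 / 12500 else 24 / ((3 : ℝ) / 4 * k) ^ 6) ≤
      58 / 625 + 65536 / 729 * (1 / 1000 - 1 / (K : ℝ) ^ 3) := by
  induction K, hK using Nat.le_induction with
  | base =>
    rw [hkh_fin_sq]
    norm_num
  | succ K hK ih =>
    rw [Finset.sum_Icc_succ_top (by omega : 2 ≤ K + 1), if_neg (show ¬ (K + 1 ≤ 2) by omega),
      if_neg (show ¬ (K + 1 ≤ 10) by omega)]
    have hstep := hkh_step_sq K hK
    push_cast
    linarith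

/-- Telescoped invariant of the second sum for `K ≥ 10`:
`∑_{k=2}^K k³ h_k ≤ 854/3125 + (49152/729)(1/100 - K⁻²)`. [folklore] -/
theorem hkh_inv_cube (K : ℕ) (hK : 10 ≤ K) :
    ∑ k ∈ Finset.Icc 2 K, (k : ℝ) ^ 3 *
        (if k ≤ 2 then (1 : ℝ) / 250 else if k ≤ 10 then 1 / 12500 else 24 / ((3 : ℝ) / 4 * k) ^ 6) ≤
      854 / 3125 + 49152 / 729 * (1 / 100 - 1 / (K : ℝ) ^ 2) := by
  induction K, hK using Nat.le_induction with
  | base =>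
    rw [hkh_fin_cube]
    norm_num
  | succ K hK ih =>
    rw [Finset.sum_Icc_succ_top (by omega : 2 ≤ K + 1), if_neg (show ¬ (K + 1 ≤ 2) by omega),
      if_neg (show ¬ (K + 1 ≤ 10) by omega)]
    have hstep := hkh_step_cube K hK
    push_cast
    linarith

/-- First sum bound: `∑_{k=2}^K 2k² h_k ≤ 1/5` for every `K`. [folklore] -/
theorem hkh_sum_sq (K : ℕ) :
    ∑ k ∈ Finset.Icc 2 K, 2 * (k : ℝ) ^ 2 *
        (if k ≤ 2 then (1 : ℝ) / 250 else if k ≤ 10 then 1 / 12500 else 24 / ((3 : ℝ) / 4 * k) ^ 6) ≤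
      1 / 5 := by
  rcases le_or_gt K 10 with hK | hK
  · calc ∑ k ∈ Finset.Icc 2 K, 2 * (k : ℝ) ^ 2 *
          (if k ≤ 2 then (1 : ℝ) / 250 else if k ≤ 10 then 1 / 12500 else 24 / ((3 : ℝ) / 4 * k) ^ 6)
        ≤ ∑ k ∈ Finset.Icc (2 : ℕ) 10, 2 * (k : ℝ) ^ 2 *
          (if k ≤ 2 then (1 : ℝ) / 250 else if k ≤ 10 then 1 / 12500 else 24 / ((3 : ℝ) / 4 * k) ^ 6) :=
          Finset.sum_le_sum_of_subset_of_nonneg (Finset.Icc_subset_Icc le_rfl hK)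
            (fun k _ _ => mul_nonneg (by positivity) (hkh_nonneg k))
      _ ≤ 1 / 5 := by
          rw [hkh_fin_sq]
          norm_num
  · have h1 := hkh_inv_sq K hK.le
    have h2 : 0 ≤ 1 / (K : ℝ) ^ 3 := by positivity
    linarith

/-- Second sum bound: `∑_{k=2}^K k³ h_k ≤ 2` for every `K`. [folklore] -/
theorem hkh_sum_cube (K : ℕ) :
    ∑ k ∈ Finset.Icc 2 K, (k : ℝ) ^ 3 *
        (if k ≤ 2 then (1 : ℝ) / 250 else if k ≤ 10 then 1 / 12500 else 24 / ((3 : ℝ) / 4 * k) ^ 6) ≤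
      2 := by
  rcases le_or_gt K 10 with hK | hK
  · calc ∑ k ∈ Finset.Icc 2 K, (k : ℝ) ^ 3 *
          (if k ≤ 2 then (1 : ℝ) / 250 else if k ≤ 10 then 1 / 12500 else 24 / ((3 : ℝ) / 4 * k) ^ 6)
        ≤ ∑ k ∈ Finset.Icc (2 : ℕ) 10, (k : ℝ) ^ 3 *
          (if k ≤ 2 then (1 : ℝ) / 250 else if k ≤ 10 then 1 / 12500 else 24 / ((3 : ℝ) / 4 * k) ^ 6) :=
          Finset.sum_le_sum_of_subset_of_nonneg (Finset.Icc_subset_Icc le_rfl hK)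
            (fun k _ _ => mul_nonneg (by positivity) (hkh_nonneg k))
      _ ≤ 2 := by
          rw [hkh_fin_cube]
          norm_num
  · have h1 := hkh_inv_cube K hK.le
    have h2 : 0 ≤ 1 / (K : ℝ) ^ 2 := by positivity
    linarith

/-- **Stub HC arithmetic `hc_hk_arith`.** The far-layer constants
`h_k = 1/250` (`k ≤ 2`), `1/12500` (`3 ≤ k ≤ 10`), `24/((3/4)k)^6` (`k ≥ 11`) satisfy `h_k ≥ 0`,
`∑_{k=2}^K 2k² h_k ≤ 1/5` and `∑_{k=2}^K k³ h_k ≤ 2` for every `K` (exact finite sums up to `k = 10`,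
telescoping tail bounds beyond). [folklore] -/
theorem hc_hk_arith : (∀ k : ℕ, 0 ≤ (if k ≤ 2 then (1 : ℝ) / 250 else if k ≤ 10 then 1 / 12500 else 24 / ((3 : ℝ) / 4 * k) ^ 6)) ∧
    (∀ K : ℕ, ∑ k ∈ Finset.Icc 2 K, 2 * (k : ℝ) ^ 2 *
      (if k ≤ 2 then (1 : ℝ) / 250 else if k ≤ 10 then 1 / 12500 else 24 / ((3 : ℝ) / 4 * k) ^ 6) ≤ 1 / 5) ∧
    (∀ K : ℕ, ∑ k ∈ Finset.Icc 2 K, (k : ℝ) ^ 3 *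
      (if k ≤ 2 then (1 : ℝ) / 250 else if k ≤ 10 then 1 / 12500 else 24 / ((3 : ℝ) / 4 * k) ^ 6) ≤ 2) :=
  ⟨hkh_nonneg, hkh_sum_sq, hkh_sum_cube⟩

end Summit.AtomisticToContinuum.Crystallization.Theorems.PeriodicWindowsDenseLaminarHull

end
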